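import Literature.Topology.PlaneTopology.HalfPlaneEnclosure
import Literature.Probability.RandomPlanarGeometry.HullApproximation
import Literature.Probability.RandomPlanarGeometry.HullSubdomainAccess
import Literature.Probability.RandomPlanarGeometry.HullThickening
import Literature.Probability.RandomPlanarGeometry.ChordalBoundary
import HarnessLib

/-!
# Smooth hulls correspond to Jordan hull subdomains

The D-side half of the transposition used by the uniqueness half of [LSW] p. 5 result 2
(`Literature.Probability.RandomPlanarGeometry.LawlerSchrammWerner2003_unique`):

* G. F. Lawler, O. Schramm, W. Werner, *Conformal restriction: the chordal case*, J. Amer.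
  Math. Soc. **16** (2003) 917–955, arXiv:math/0209343 (**[LSW]**), §2 p. 8 (smooth hulls).

For a chordal uniformizing map `φ : (ℍ; 0, ∞) → (D; a, b)` of a Dobrushin domain and a smooth
`*`-hull `J` (`IsArcHull J`, `0 ∉ J`: the part of `∂J` in `ℍ` is the interior of a Jordan arc
`γ` with distinct real endpoints `x₀ < x₁`), the image `φ(ℍ ∖ J)` is the carrier of a Dobrushin
domain `D_J` which is a HULL SUBDOMAIN of `D` (`MarkedDomain.IsHullSubdomain`) with
`φ.pullbackHull D_J = J` (`exists_isHullSubdomain_of_isArcHull`). Hence two-sided restriction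
over Jordan hull subdomains yields, after pull-back, multiplicativity of the avoidance
probabilities over smooth hulls (`RestrictionConfig.IsArcHullMultiplicative`).

## Proof

1. (`ℍ`-side, `IsArcHull.sides`) Apply the Jordan curve theorem (`hJ`) to the symmetric curve
   `γ ∪ γ̄` (`JordanCurveTheorem.symmetric`): `ℂ ∖ (γ ∪ γ̄) = U ⊔ V`, `U` bounded. The connected
   unbounded set `ℍ ∖ J` lies in `V`, both `U` and `V` are symmetric, and the real interval
   `(x₀, x₁)` lies in `U` — otherwise `U` would sit inside `int J ∪ conj(int J)`, on one side of
   `ℝ`, contradicting its symmetry. So no point of `(x₀, x₁)` is in the closure of `ℍ ∖ J`, and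
   `[x₀, x₁] ⊆ J` (in particular `0 ∉ [x₀, x₁]`).
2. (disc) Transport by the Cayley map `C` (`C(x) = e^{i(π + 2 arctan x)}` on `ℝ`): the loop
   `C ∘ γ` followed by the arc of the unit circle from `C(x₁)` through `1 = C(∞)` to `C(x₀)` is a
   simple closed curve in the closed disc, passing through `-1 = C(0)` and `1`.
3. (D-side) Push the loop forward by the Carathéodory homeomorphism `Ψ` of the closed disc onto
   `cl D` (`hC`, with `Ψ ∘ C = φ`, `Ψ(-1) = a`, `Ψ(1) = b`). The open connected bounded set
   `W = φ(ℍ ∖ J)` misses the image loop and has its frontier inside it (step 1 controls the real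
   frontier points of `ℍ ∖ J`), so by the Jordan curve theorem for the image loop `W` is its
   inside and the loop is `∂W`. Re-parametrising the loop to start at `a` gives the Dobrushin
   domain `D_J = (W; a, b)`; `a, b ∉ cl(D ∖ W) ⊆ Ψ(C(J))` as `0 ∉ J`.
-/

noncomputable section

open Set Filter Topology Metric Complex Function
open UpperHalfPlane (upperHalfPlaneSet isOpen_upperHalfPlaneSet)
open scoped unitInterval Real ComplexConjugate

namespace Literature.Probability.RandomPlanarGeometry

/-! ### The arc of a smooth hull as a path, and the sides of `γ ∪ γ̄` -/

section Sides

variable {J : Set ℂ}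

/-- **Normal form of a smooth hull**: the arc as an injective path from `x₀` to `x₁` with
`x₀ < x₁` real, interior in `ℍ`, tracing `ℍ ∩ ∂J` on `(0, 1)`. [folklore] -/
theorem IsArcHull.exists_path (hJ : IsArcHull J) :
    ∃ (x₀ x₁ : ℝ) (P : Path (x₀ : ℂ) (x₁ : ℂ)), x₀ < x₁ ∧ Injective P ∧
      (∀ s : I, 0 < (s : ℝ) → (s : ℝ) < 1 → 0 < (P s).im) ∧
      upperHalfPlaneSet ∩ frontier J = P '' {s : I | 0 < (s : ℝ) ∧ (s : ℝ) < 1} := by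
  obtain ⟨-, γ₀, hγc₀, hγi₀, h0₀, h1₀, hI₀, hfr₀⟩ := hJ
  -- arrange `(γ 0).re < (γ 1).re` by reversing the parametrisation if necessary
  obtain ⟨γ, hγc, hγi, h0, h1, hI, hfr, hlt⟩ : ∃ γ : ℝ → ℂ, ContinuousOn γ (Icc 0 1) ∧
      InjOn γ (Icc 0 1) ∧ (γ 0).im = 0 ∧ (γ 1).im = 0 ∧ (∀ t ∈ Ioo (0 : ℝ) 1, 0 < (γ t).im) ∧
      upperHalfPlaneSet ∩ frontier J = γ '' Ioo 0 1 ∧ (γ 0).re < (γ 1).re := by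
    have hne : γ₀ 0 ≠ γ₀ 1 := fun h ↦ by
      have := hγi₀ (by simp) (by simp) h
      norm_num at this
    have hre : (γ₀ 0).re ≠ (γ₀ 1).re := fun h ↦ hne (Complex.ext h (by rw [h0₀, h1₀]))
    rcases hre.lt_or_gt with hlt | hgt
    · exact ⟨γ₀, hγc₀, hγi₀, h0₀, h1₀, hI₀, hfr₀, hlt⟩
    · refine ⟨fun t ↦ γ₀ (1 - t), ?_, ?_, by simpa using h1₀, by simpa using h0₀, ?_, ?_, by simpa using hgt⟩
      · exact hγc₀.comp (continuous_const.sub continuous_id).continuousOn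
          (fun t ht ↦ ⟨by linarith [ht.2], by linarith [ht.1]⟩)
      · intro s hs t ht hst
        have := hγi₀ ⟨by linarith [hs.2], by linarith [hs.1]⟩ ⟨by linarith [ht.2], by linarith [ht.1]⟩ hst
        linarith
      · intro t ht
        exact hI₀ (1 - t) ⟨by linarith [ht.2], by linarith [ht.1]⟩
      · rw [hfr₀]
        ext z
        simp only [mem_image, mem_Ioo]
        constructor
        · rintro ⟨t, ht, rfl⟩
          exact ⟨1 - t, ⟨by linarith [ht.2], by linarith [ht.1]⟩, by simp⟩
        · rintro ⟨t, ht, rfl⟩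
          exact ⟨1 - t, ⟨by linarith [ht.2], by linarith [ht.1]⟩, rfl⟩
  set x₀ : ℝ := (γ 0).re with hx₀
  set x₁ : ℝ := (γ 1).re with hx₁
  have hγ0 : γ 0 = (x₀ : ℂ) := Complex.ext (by simp [hx₀]) (by simp [h0])
  have hγ1 : γ 1 = (x₁ : ℂ) := Complex.ext (by simp [hx₁]) (by simp [h1])
  have hcont : Continuous fun s : I ↦ γ s := hγc.comp_continuous continuous_subtype_val fun s ↦ s.2
  set P : Path (x₀ : ℂ) (x₁ : ℂ) :=
    { toFun := fun s ↦ γ s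
      continuous_toFun := hcont
      source' := by simp [hγ0]
      target' := by simp [hγ1] } with hP
  refine ⟨x₀, x₁, P, hlt, fun s t hst ↦ Subtype.ext (hγi s.2 t.2 hst), fun s hs0 hs1 ↦ hI s ⟨hs0, hs1⟩, ?_⟩
  rw [hfr]
  ext z
  simp only [mem_image, mem_Ioo, mem_setOf_eq]
  constructor
  · rintro ⟨t, ht, rfl⟩
    exact ⟨⟨t, ht.1.le, ht.2.le⟩, ht, rfl⟩
  · rintro ⟨s, hs, rfl⟩
    exact ⟨s, hs, rfl⟩

/-- The endpoints of a path are limits of interior parameters: `range P ⊆ closure (P(0,1))`. [folklore] -/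
theorem range_path_subset_closure_image {a b : ℂ} (P : Path a b) :
    range P ⊆ closure (P '' {s : I | 0 < (s : ℝ) ∧ (s : ℝ) < 1}) := by
  rintro _ ⟨s, rfl⟩
  have hdense : (s : I) ∈ closure {s : I | 0 < (s : ℝ) ∧ (s : ℝ) < 1} := by
    rw [Metric.mem_closure_iff]
    intro ε hε
    -- move `s` towards `1/2` by a small amount
    set u : ℝ := (s : ℝ) + (min (ε / 2) (1 / 2)) * ((1 / 2 : ℝ) - s) with hu
    have hm : 0 < min (ε / 2) (1 / 2) := lt_min (by linarith) (by norm_num)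
    have hm1 : min (ε / 2) (1 / 2) ≤ 1 / 2 := min_le_right _ _
    have hs0 : 0 ≤ (s : ℝ) := s.2.1
    have hs1 : (s : ℝ) ≤ 1 := s.2.2
    have hu0 : 0 < u := by
      rw [hu]
      nlinarith
    have hu1 : u < 1 := by
      rw [hu]
      nlinarith
    refine ⟨⟨u, hu0.le, hu1.le⟩, ⟨hu0, hu1⟩, ?_⟩
    rw [Subtype.dist_eq, Real.dist_eq]
    show |(s : ℝ) - u| < ε
    rw [hu]
    have : |(s : ℝ) - ((s : ℝ) + min (ε / 2) (1 / 2) * (1 / 2 - (s : ℝ)))| =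
        min (ε / 2) (1 / 2) * |1 / 2 - (s : ℝ)| := by
      rw [show (s : ℝ) - ((s : ℝ) + min (ε / 2) (1 / 2) * (1 / 2 - (s : ℝ))) =
        -(min (ε / 2) (1 / 2) * (1 / 2 - (s : ℝ))) by ring, abs_neg, abs_mul, abs_of_pos hm]
    rw [this]
    have h12 : |1 / 2 - (s : ℝ)| ≤ 1 / 2 := abs_le.2 ⟨by linarith, by linarith⟩
    calc min (ε / 2) (1 / 2) * |1 / 2 - (s : ℝ)| ≤ (ε / 2) * (1 / 2) :=
          mul_le_mul (min_le_left _ _) h12 (abs_nonneg _) (by linarith)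
      _ < ε := by linarith
  exact (P.continuous.continuousAt.continuousWithinAt).mem_closure_image hdense

/-- **The two sides of `γ ∪ γ̄` for a smooth hull** (from the Jordan curve theorem `hJCT`): with
the arc `P` of `IsArcHull.exists_path`, no real point of `(x₀, x₁)` is in the closure of `ℍ ∖ J`,
and `[x₀, x₁] ⊆ J`. See the module docstring, step 1. [folklore] -/
theorem IsArcHull.sides (hJCT : Literature.Topology.PlaneTopology.JordanCurveTheorem) (hJ : IsArcHull J) :
    ∃ (x₀ x₁ : ℝ) (P : Path (x₀ : ℂ) (x₁ : ℂ)), x₀ < x₁ ∧ Injective P ∧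
      (∀ s : I, 0 ≤ (P s).im) ∧ (∀ s : I, (P s).im = 0 → P s = x₀ ∨ P s = x₁) ∧ range P ⊆ J ∧
      upperHalfPlaneSet ∩ frontier J = P '' {s : I | 0 < (s : ℝ) ∧ (s : ℝ) < 1} ∧
      (∀ x : ℝ, x₀ < x → x < x₁ → (x : ℂ) ∉ closure (upperHalfPlaneSet \ J)) ∧
      (∀ x : ℝ, x₀ ≤ x → x ≤ x₁ → (x : ℂ) ∈ J) := by
  obtain ⟨x₀, x₁, P, hlt, hPi, hI, hfr⟩ := hJ.exists_path
  have hJc : IsClosed J := hJ.1.isClosed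
  -- imaginary parts along the arc
  have him : ∀ s, 0 ≤ (P s).im := by
    intro s
    rcases eq_or_lt_of_le s.2.1 with h0 | h0
    · have : s = 0 := Subtype.ext h0.symm
      subst this
      simp
    rcases eq_or_lt_of_le s.2.2 with h1 | h1
    · have : s = 1 := Subtype.ext h1
      subst this
      simp
    exact (hI s h0 h1).le
  have hreal : ∀ s, (P s).im = 0 → P s = x₀ ∨ P s = x₁ := by
    intro s hs
    rcases eq_or_lt_of_le s.2.1 with h0 | h0
    · left
      have : s = 0 := Subtype.ext h0.symm
      subst this
      simp
    rcases eq_or_lt_of_le s.2.2 with h1 | h1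
    · right
      have : s = 1 := Subtype.ext h1
      subst this
      simp
    exact absurd hs (hI s h0 h1).ne'
  obtain ⟨U, V, hUo, hVo, hUc, hVc, hUV, hunion, hfU, -, hUb, hVb⟩ :=
    hJCT.symmetric P hPi him hreal
  set Λ : Set ℂ := range P ∪ conj '' range P with hΛ
  -- the arc lies in `J`
  have hPJ : range P ⊆ J := by
    have h1 : P '' {s : I | 0 < (s : ℝ) ∧ (s : ℝ) < 1} ⊆ frontier J := by
      rw [← hfr]; exact inter_subset_right
    exact (range_path_subset_closure_image P).trans
      ((closure_mono h1).trans (isClosed_frontier.closure_subset.trans hJc.frontier_subset))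
  refine ⟨x₀, x₁, P, hlt, hPi, him, hreal, hPJ, hfr, ?_⟩
  -- real points of `Λ`
  have hΛreal : ∀ w ∈ Λ, w.im = 0 → w = x₀ ∨ w = x₁ := by
    rintro w (⟨s, rfl⟩ | ⟨_, ⟨s, rfl⟩, rfl⟩) hw
    · exact hreal s hw
    · have hs : (P s).im = 0 := by
        have : (conj (P s)).im = 0 := hw
        rw [conj_im] at this
        linarith
      rcases hreal s hs with h | h
      · left; rw [h, conj_ofReal]
      · right; rw [h, conj_ofReal]
  have hΛim : ∀ w ∈ Λ, 0 < w.im → w ∈ range P := by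
    rintro w (hw | ⟨_, ⟨s, rfl⟩, rfl⟩) hpos
    · exact hw
    · exfalso
      rw [conj_im] at hpos
      linarith [him s]
  have hsubU : ∀ {S : Set ℂ}, IsPreconnected S → S ⊆ Λᶜ → S ⊆ U ∨ S ⊆ V := fun hS hSΛ ↦
    hS.subset_or_subset hUo hVo hUV (hunion.symm ▸ hSΛ)
  -- (i) `ℍ ∖ J ⊆ V`
  have hHJV : upperHalfPlaneSet \ J ⊆ V := by
    have hconn : IsConnected (upperHalfPlaneSet \ J) := hJ.1.2.2.isPathConnected.isConnected
    obtain ⟨R, hR⟩ := hJ.1.1.subset_closedBall 0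
    have hunb : ¬ Bornology.IsBounded (upperHalfPlaneSet \ J) := fun hb ↦ by
      set z : ℂ := ((|R| + 1 : ℝ) : ℂ) * Complex.I with hz
      refine not_isBounded_upRay z (hb.subset fun w hw ↦ ?_)
      have hzim : 0 < z.im := by simp [hz]; positivity
      have hzn : ‖z‖ = |R| + 1 := by
        rw [hz, norm_mul, norm_real, norm_I, mul_one, Real.norm_eq_abs, abs_of_pos (by positivity)]
      refine ⟨hzim.trans_le (mem_upRay_iff.1 hw).2, fun hwJ ↦ ?_⟩
      have h1 := hR hwJ
      rw [mem_closedBall, dist_zero_right] at h1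
      have h2 := norm_le_of_mem_upRay hzim.le hw
      linarith [le_abs_self R]
    have hdisj : upperHalfPlaneSet \ J ⊆ Λᶜ := by
      intro z hz hzΛ
      exact hz.2 (hPJ (hΛim z hzΛ hz.1))
    rcases hsubU hconn.isPreconnected hdisj with h | h
    · exact absurd (hUb.subset h) hunb
    · exact h
  -- (ii) symmetry of the two sides
  have hΛsymm : conj '' Λ = Λ := by
    rw [hΛ, image_union, ← image_comp, union_comm]
    congr 1
    ext w; simp
  have hΛc_symm : ∀ {S : Set ℂ}, S ⊆ Λᶜ → conj '' S ⊆ Λᶜ := by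
    rintro S hS _ ⟨w, hw, rfl⟩ hmem
    have : conj (conj w) ∈ conj '' Λ := ⟨_, hmem, rfl⟩
    rw [conj_conj, hΛsymm] at this
    exact hS hw this
  have hconjconj : ∀ S : Set ℂ, conj '' (conj '' S) = S := fun S ↦ by
    rw [← image_comp]; ext w; simp
  have hVsymm : conj '' V ⊆ V := by
    rcases hsubU (hVc.isPreconnected.image _ continuous_conj.continuousOn)
      (hΛc_symm (hunion ▸ subset_union_right)) with h | h
    · exfalso
      refine hVb ?_
      rw [← hconjconj V]
      exact isometry_conj.lipschitz.isBounded_image (hUb.subset h)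
    · exact h
  have hUsymm : conj '' U ⊆ U := by
    rcases hsubU (hUc.isPreconnected.image _ continuous_conj.continuousOn)
      (hΛc_symm (hunion ▸ subset_union_left)) with h | h
    · exact h
    · exfalso
      obtain ⟨u, hu⟩ := hUc.nonempty
      have h1 : u ∈ V := by
        have : conj (conj u) ∈ conj '' V := ⟨_, h ⟨u, hu, rfl⟩, rfl⟩
        rw [conj_conj] at this
        exact hVsymm this
      exact Set.disjoint_left.1 hUV hu h1
  -- (iii) the outer real rays lie in `V`
  obtain ⟨RU, hRU⟩ := hUb.subset_closedBall 0
  have hfarV : ∀ w ∈ Λᶜ, RU < ‖w‖ → w ∈ V := fun w hw hwR ↦ by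
    rcases (show w ∈ U ∪ V by rw [hunion]; exact hw) with h | h
    · have := hRU h
      rw [mem_closedBall, dist_zero_right] at this
      linarith
    · exact h
  have hrealΛc : ∀ x : ℝ, x ≠ x₀ → x ≠ x₁ → (x : ℂ) ∈ Λᶜ := fun x h0 h1 hx ↦ by
    rcases hΛreal _ hx (by simp) with h | h
    · exact h0 (by exact_mod_cast h)
    · exact h1 (by exact_mod_cast h)
  have hrayVpos : ∀ x : ℝ, x₁ < x → (x : ℂ) ∈ V := by
    intro x hx
    set Rr : Set ℂ := (fun y : ℝ ↦ (y : ℂ)) '' Ioi x₁ with hRr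
    have hRc : IsPreconnected Rr := isPreconnected_Ioi.image _ continuous_ofReal.continuousOn
    have hRΛ : Rr ⊆ Λᶜ := by
      rintro _ ⟨y, hy, rfl⟩
      exact hrealΛc y (by linarith [mem_Ioi.1 hy]) (ne_of_gt hy)
    rcases hsubU hRc hRΛ with h | h
    · exfalso
      set y : ℝ := max x₁ RU + 1 with hy
      have hyR : (y : ℂ) ∈ Rr := ⟨y, by rw [mem_Ioi, hy]; linarith [le_max_left x₁ RU], rfl⟩
      have hyV : (y : ℂ) ∈ V := hfarV _ (hRΛ hyR) (by
        rw [norm_real, Real.norm_eq_abs, hy]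
        have : RU < max x₁ RU + 1 := by linarith [le_max_right x₁ RU]
        exact this.trans_le (le_abs_self _))
      exact Set.disjoint_left.1 hUV (h hyR) hyV
    · exact h ⟨x, hx, rfl⟩
  have hrayVneg : ∀ x : ℝ, x < x₀ → (x : ℂ) ∈ V := by
    intro x hx
    set Rr : Set ℂ := (fun y : ℝ ↦ (y : ℂ)) '' Iio x₀ with hRr
    have hRc : IsPreconnected Rr := isPreconnected_Iio.image _ continuous_ofReal.continuousOn
    have hRΛ : Rr ⊆ Λᶜ := by
      rintro _ ⟨y, hy, rfl⟩
      exact hrealΛc y (ne_of_lt hy) (by linarith [mem_Iio.1 hy])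
    rcases hsubU hRc hRΛ with h | h
    · exfalso
      set y : ℝ := -(max (-x₀) RU + 1) with hy
      have hyR : (y : ℂ) ∈ Rr := ⟨y, by rw [mem_Iio, hy]; linarith [le_max_left (-x₀) RU], rfl⟩
      have hyV : (y : ℂ) ∈ V := hfarV _ (hRΛ hyR) (by
        rw [norm_real, Real.norm_eq_abs, hy, abs_neg]
        have : RU < max (-x₀) RU + 1 := by linarith [le_max_right (-x₀) RU]
        exact this.trans_le (le_abs_self _))
      exact Set.disjoint_left.1 hUV (h hyR) hyV
    · exact h ⟨x, hx, rfl⟩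
  -- points of `U` in `ℍ` are interior points of `J`
  have hUint : ∀ u ∈ U, 0 < u.im → u ∈ interior J := by
    intro u hu hpos
    have huΛ : u ∉ Λ := fun h ↦ (show u ∈ Λᶜ by rw [← hunion]; exact Or.inl hu) h
    have huJ : u ∈ J := by
      by_contra h
      exact Set.disjoint_left.1 hUV hu (hHJV ⟨hpos, h⟩)
    have hufr : u ∉ frontier J := fun h ↦ by
      have : u ∈ upperHalfPlaneSet ∩ frontier J := ⟨hpos, h⟩
      rw [hfr] at this
      obtain ⟨s, -, hs⟩ := this
      exact huΛ (Or.inl ⟨s, hs⟩)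
    rw [← self_sdiff_frontier]
    exact ⟨huJ, hufr⟩
  -- (iv) the middle interval lies in `U`
  set M : Set ℂ := (fun y : ℝ ↦ (y : ℂ)) '' Ioo x₀ x₁ with hM
  have hMΛ : M ⊆ Λᶜ := by
    rintro _ ⟨y, hy, rfl⟩
    exact hrealΛc y (ne_of_gt hy.1) (ne_of_lt hy.2)
  have hMU : M ⊆ U := by
    rcases hsubU (isPreconnected_Ioo.image _ continuous_ofReal.continuousOn) hMΛ with h | hMV
    · exact h
    exfalso
    -- then `U` sits inside `int J ∪ conj(int J)`
    set Sp : Set ℂ := interior J ∩ upperHalfPlaneSet with hSp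
    set Sm : Set ℂ := conj ⁻¹' Sp with hSm
    have hSpo : IsOpen Sp := isOpen_interior.inter isOpen_upperHalfPlaneSet
    have hSmo : IsOpen Sm := hSpo.preimage continuous_conj
    have hdisj : Disjoint Sp Sm := by
      rw [Set.disjoint_left]
      rintro w ⟨-, hw⟩ ⟨-, hw'⟩
      have h1 : 0 < w.im := hw
      have h2 : 0 < (conj w).im := hw'
      rw [conj_im] at h2
      linarith
    have hUsub : U ⊆ Sp ∪ Sm := by
      intro u hu
      have huΛ : u ∈ Λᶜ := by rw [← hunion]; exact Or.inl hu
      rcases lt_trichotomy u.im 0 with hneg | hzero | hpos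
      · right
        have hcu : conj u ∈ U := hUsymm ⟨u, hu, rfl⟩
        have hcpos : 0 < (conj u).im := by rw [conj_im]; linarith
        exact ⟨hUint _ hcu hcpos, hcpos⟩
      · exfalso
        have hure : u = ((u.re : ℝ) : ℂ) := Complex.ext (by simp) (by simp [hzero])
        rcases lt_trichotomy u.re x₀ with h | h | h
        · exact Set.disjoint_left.1 hUV hu (hure ▸ hrayVneg u.re h)
        · exact huΛ (Or.inl ⟨0, by rw [P.source, hure, h]⟩)
        rcases lt_trichotomy u.re x₁ with h' | h' | h'
        · exact Set.disjoint_left.1 hUV hu (hMV ⟨u.re, ⟨h, h'⟩, hure.symm⟩)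
        · exact huΛ (Or.inl ⟨1, by rw [P.target, hure, h']⟩)
        · exact Set.disjoint_left.1 hUV hu (hure ▸ hrayVpos u.re h')
      · exact Or.inl ⟨hUint u hu hpos, hpos⟩
    obtain ⟨u₀, hu₀⟩ := hUc.nonempty
    have hcu₀ : conj u₀ ∈ U := hUsymm ⟨u₀, hu₀, rfl⟩
    rcases hUc.isPreconnected.subset_or_subset hSpo hSmo hdisj hUsub with h | h
    · have h1 : 0 < u₀.im := (h hu₀).2
      have h2 : 0 < (conj u₀).im := (h hcu₀).2
      rw [conj_im] at h2
      linarith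
    · have h1 : 0 < (conj u₀).im := (h hu₀).2
      have h2 : 0 < (conj (conj u₀)).im := (h hcu₀).2
      rw [conj_conj] at h2
      rw [conj_im] at h1
      linarith
  -- (v) conclusions
  refine ⟨fun x hx0 hx1 hxcl ↦ ?_, fun x hx0 hx1 ↦ ?_⟩
  · have hxU : (x : ℂ) ∈ U := hMU ⟨x, ⟨hx0, hx1⟩, rfl⟩
    have hsub : upperHalfPlaneSet \ J ⊆ Uᶜ := fun z hz hzU ↦ Set.disjoint_left.1 hUV hzU (hHJV hz)
    exact (closure_minimal hsub hUo.isClosed_compl) hxcl hxU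
  · rcases eq_or_lt_of_le hx0 with h0 | h0
    · subst h0
      exact hPJ ⟨0, P.source⟩
    rcases eq_or_lt_of_le hx1 with h1 | h1
    · rw [h1]
      exact hPJ ⟨1, P.target⟩
    -- `x ∈ U`, and points `x + iε ∈ U ∩ ℍ ⊆ J` accumulate at `x`
    have hxU : (x : ℂ) ∈ U := hMU ⟨x, ⟨h0, h1⟩, rfl⟩
    have hUHJ : U ∩ upperHalfPlaneSet ⊆ J := fun w hw ↦ by
      by_contra h
      exact Set.disjoint_left.1 hUV hw.1 (hHJV ⟨hw.2, h⟩)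
    have hseq : Tendsto (fun n : ℕ ↦ (x : ℂ) + ((1 : ℝ) / (n + 1) : ℝ) * Complex.I) atTop
        (𝓝 (x : ℂ)) := by
      have h1 : Tendsto (fun n : ℕ ↦ ((1 : ℝ) / (n + 1) : ℝ)) atTop (𝓝 0) :=
        tendsto_one_div_add_atTop_nhds_zero_nat
      have h2 : Tendsto (fun n : ℕ ↦ (((1 : ℝ) / (n + 1) : ℝ) : ℂ) * Complex.I) atTop
          (𝓝 (((0 : ℝ) : ℂ) * Complex.I)) :=
        ((continuous_ofReal.tendsto 0).comp h1).mul tendsto_const_nhds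
      simpa using tendsto_const_nhds.add h2
    have hev : ∀ᶠ n : ℕ in atTop, (x : ℂ) + ((1 : ℝ) / (n + 1) : ℝ) * Complex.I ∈ J := by
      have hevU := hseq.eventually (hUo.mem_nhds hxU)
      filter_upwards [hevU] with n hn
      refine hUHJ ⟨hn, ?_⟩
      show 0 < ((x : ℂ) + ((1 : ℝ) / (n + 1) : ℝ) * Complex.I).im
      rw [add_im, ofReal_im, mul_I_im, ofReal_re, zero_add]
      positivity
    exact hJc.mem_of_tendsto hseq hev

end Sides

/-! ### The Cayley transform on the real line and the boundary arc of the disc -/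

section Arc

/-- The Cayley transform is injective on the closed upper half-plane. [folklore] -/
theorem cayleyFun_injOn : InjOn cayleyFun {z : ℂ | 0 ≤ z.im} := fun z hz w hw h ↦ by
  have h1 := congrArg cayleyInvFun h
  rwa [cayleyInvFun_cayleyFun (add_I_ne_zero hz), cayleyInvFun_cayleyFun (add_I_ne_zero hw)] at h1

/-- `cayleyFun 0 = -1`. [folklore] -/
theorem cayleyFun_zero : cayleyFun 0 = -1 := by
  rw [cayleyFun_apply, zero_sub, zero_add, neg_div, div_self I_ne_zero]

/-- **A rational parametrisation of the unit circle minus `cayleyFun m`**: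
`arcFun m u = cayleyFun (m - 1/u)` for `u ≠ 0` and `arcFun m 0 = 1 = cayleyFun ∞`. [folklore] -/
def arcFun (m u : ℝ) : ℂ := (((m * u - 1 : ℝ) : ℂ) - u * Complex.I) / (((m * u - 1 : ℝ) : ℂ) + u * Complex.I)

/-- The denominator of `arcFun` never vanishes. [folklore] -/
theorem arcFun_den_ne_zero (m u : ℝ) : ((m * u - 1 : ℝ) : ℂ) + u * Complex.I ≠ 0 := by
  intro h
  have hre := congrArg Complex.re h
  have him := congrArg Complex.im h
  simp at hre him
  rw [him] at hre
  norm_num at hre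

/-- `arcFun m 0 = 1`. [folklore] -/
theorem arcFun_zero (m : ℝ) : arcFun m 0 = 1 := by
  rw [arcFun]
  simp

/-- `arcFun m u = cayleyFun (m - 1/u)` for `u ≠ 0`. [folklore] -/
theorem arcFun_of_ne_zero (m : ℝ) {u : ℝ} (hu : u ≠ 0) :
    arcFun m u = cayleyFun ((m - 1 / u : ℝ) : ℂ) := by
  rw [arcFun, cayleyFun_apply]
  have hu' : (u : ℂ) ≠ 0 := by exact_mod_cast hu
  rw [div_eq_div_iff (arcFun_den_ne_zero m u) (add_I_ne_zero (by simp))]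
  push_cast
  field_simp

/-- `arcFun` takes values on the unit circle. [folklore] -/
theorem norm_arcFun (m u : ℝ) : ‖arcFun m u‖ = 1 := by
  rw [arcFun, norm_div, div_eq_one_iff_eq (norm_ne_zero_iff.2 (arcFun_den_ne_zero m u))]
  have h1 : ‖((m * u - 1 : ℝ) : ℂ) - u * Complex.I‖ ^ 2 = ‖((m * u - 1 : ℝ) : ℂ) + u * Complex.I‖ ^ 2 := by
    rw [← Complex.normSq_eq_norm_sq, ← Complex.normSq_eq_norm_sq, Complex.normSq_apply,
      Complex.normSq_apply]
    simp
  exact (sq_eq_sq₀ (norm_nonneg _) (norm_nonneg _)).1 h1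

/-- `arcFun m` is continuous. [folklore] -/
theorem continuous_arcFun (m : ℝ) : Continuous (arcFun m) := by
  unfold arcFun
  exact Continuous.div (by fun_prop) (by fun_prop) (arcFun_den_ne_zero m)

/-- `arcFun m` is injective. [folklore] -/
theorem arcFun_injective (m : ℝ) : Injective (arcFun m) := by
  intro u v h
  by_cases hu : u = 0
  · subst hu
    by_contra hv
    rw [arcFun_zero, arcFun_of_ne_zero m (Ne.symm hv)] at h
    exact cayleyFun_ne_one _ h.symm
  by_cases hv : v = 0
  · subst hv
    rw [arcFun_zero, arcFun_of_ne_zero m hu] at h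
    exact absurd h (cayleyFun_ne_one _)
  rw [arcFun_of_ne_zero m hu, arcFun_of_ne_zero m hv] at h
  have h1 := cayleyFun_injOn (by simp) (by simp) h
  have h2 : (m - 1 / u : ℝ) = m - 1 / v := by exact_mod_cast h1
  field_simp at h2
  linarith [h2]

variable {x₀ x₁ : ℝ}

/-- **The boundary arc of the disc**: from `cayleyFun x₁` through `1` to `cayleyFun x₀`, the
image of `ℝ̂ ∖ (x₀, x₁)` under the Cayley transform, parametrised rationally through the
midpoint `m = (x₀ + x₁)/2`. [folklore] -/
def boundaryArc (h : x₀ < x₁) : Path (cayleyFun (x₁ : ℂ)) (cayleyFun (x₀ : ℂ)) where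
  toFun s := arcFun ((x₀ + x₁) / 2)
    (1 / ((x₀ + x₁) / 2 - x₁) + (s : ℝ) * (1 / ((x₀ + x₁) / 2 - x₀) - 1 / ((x₀ + x₁) / 2 - x₁)))
  continuous_toFun := (continuous_arcFun _).comp (by fun_prop)
  source' := by
    simp only [Set.Icc.coe_zero, zero_mul, add_zero]
    rw [arcFun_of_ne_zero _ (one_div_ne_zero (by linarith))]
    congr 1
    push_cast
    field_simp
    ring
  target' := by
    simp only [Set.Icc.coe_one, one_mul, add_sub_cancel]
    rw [arcFun_of_ne_zero _ (one_div_ne_zero (by linarith))]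
    congr 1
    push_cast
    field_simp
    ring

/-- The boundary arc is injective. [folklore] -/
theorem boundaryArc_injective (h : x₀ < x₁) : Injective (boundaryArc h) := by
  intro s t hst
  have h1 := arcFun_injective _ hst
  have hne : 1 / ((x₀ + x₁) / 2 - x₀) - 1 / ((x₀ + x₁) / 2 - x₁) ≠ 0 := by
    have ha : 0 < 1 / ((x₀ + x₁) / 2 - x₀) := one_div_pos.2 (by linarith)
    have hb : 1 / ((x₀ + x₁) / 2 - x₁) < 0 := one_div_neg.2 (by linarith)
    linarith
  have h2 : (s : ℝ) = t := by
    have := add_left_cancel h1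
    exact mul_right_cancel₀ hne this
  exact Subtype.ext h2

/-- The boundary arc lies on the unit circle. [folklore] -/
theorem norm_boundaryArc (h : x₀ < x₁) (s : I) : ‖boundaryArc h s‖ = 1 :=
  norm_arcFun _ _

/-- `1` lies on the boundary arc. [folklore] -/
theorem one_mem_range_boundaryArc (h : x₀ < x₁) : (1 : ℂ) ∈ range (boundaryArc h) := by
  set a : ℝ := 1 / ((x₀ + x₁) / 2 - x₁) with ha
  set b : ℝ := 1 / ((x₀ + x₁) / 2 - x₀) with hb
  have ha' : a < 0 := one_div_neg.2 (by linarith)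
  have hb' : 0 < b := one_div_pos.2 (by linarith)
  refine ⟨⟨-a / (b - a), div_nonneg (by linarith) (by linarith), (div_le_one (by linarith)).2 (by linarith)⟩, ?_⟩
  show arcFun _ (a + (-a / (b - a)) * (b - a)) = 1
  rw [div_mul_cancel₀ _ (by linarith : b - a ≠ 0), add_neg_cancel, arcFun_zero]

/-- **Real points outside `(x₀, x₁)` are on the boundary arc.** [folklore] -/
theorem cayleyFun_mem_range_boundaryArc (h : x₀ < x₁) {y : ℝ} (hy : y ≤ x₀ ∨ x₁ ≤ y) :
    cayleyFun (y : ℂ) ∈ range (boundaryArc h) := by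
  set m : ℝ := (x₀ + x₁) / 2 with hm
  set a : ℝ := 1 / (m - x₁) with ha
  set b : ℝ := 1 / (m - x₀) with hb
  have hmx₀ : 0 < m - x₀ := by rw [hm]; linarith
  have hmx₁ : m - x₁ < 0 := by rw [hm]; linarith
  have ha' : a < 0 := one_div_neg.2 hmx₁
  have hb' : 0 < b := one_div_pos.2 hmx₀
  -- the parameter `u = 1/(m - y)`
  have hmy : m - y ≠ 0 := by
    rcases hy with hy | hy
    · linarith
    · linarith
  set u : ℝ := 1 / (m - y) with hu
  have hu0 : u ≠ 0 := one_div_ne_zero hmy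
  have hua : a ≤ u := by
    rcases hy with hy | hy
    · exact ha'.le.trans (one_div_pos.2 (by linarith)).le
    · rw [ha, hu]
      exact one_div_le_one_div_of_neg_of_le hmx₁ (by linarith)
  have hub : u ≤ b := by
    rcases hy with hy | hy
    · rw [hb, hu]
      exact one_div_le_one_div_of_le hmx₀ (by linarith)
    · exact (one_div_neg.2 (by linarith : m - y < 0)).le.trans hb'.le
  have hba : 0 < b - a := by linarith
  refine ⟨⟨(u - a) / (b - a), div_nonneg (by linarith) hba.le, (div_le_one hba).2 (by linarith)⟩, ?_⟩
  show arcFun m (a + (u - a) / (b - a) * (b - a)) = cayleyFun (y : ℂ)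
  rw [div_mul_cancel₀ _ hba.ne', add_sub_cancel, arcFun_of_ne_zero m hu0]
  congr 2
  rw [hu, one_div_one_div]
  ring

end Arc

/-! ### Closures under the Cayley transform; periodic loops -/

section Tools

/-- **Closure of a Cayley image**: limit points of `cayleyFun(S)`, `S ⊆ ℍ̄`, come from limit
points of `S` or are the point `1 = cayleyFun(∞)`. [folklore] -/
theorem closure_image_cayleyFun_subset {S : Set ℂ} (hS : S ⊆ closure upperHalfPlaneSet) :
    closure (cayleyFun '' S) ⊆ cayleyFun '' closure S ∪ {1} := by
  intro q hq
  by_cases hq1 : q = 1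
  · exact Or.inr hq1
  left
  have hε : 0 < dist q 1 / 2 := half_pos (dist_pos.2 hq1)
  -- far out, `cayleyFun` is close to `1`
  have hev : ∀ᶠ z in cocompact ℂ, dist (cayleyFun z) 1 < dist q 1 / 2 :=
    tendsto_cayleyFun_cocompact (ball_mem_nhds _ hε)
  rw [Filter.Eventually, mem_cocompact] at hev
  obtain ⟨K, hK, hKsub⟩ := hev
  have hsplit : cayleyFun '' S ⊆ cayleyFun '' (S ∩ K) ∪ closedBall 1 (dist q 1 / 2) := by
    rintro _ ⟨z, hz, rfl⟩
    by_cases hzK : z ∈ K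
    · exact Or.inl ⟨z, ⟨hz, hzK⟩, rfl⟩
    · exact Or.inr (mem_closedBall.2 (hKsub hzK).le)
  have hq' : q ∈ closure (cayleyFun '' (S ∩ K)) := by
    have := closure_mono hsplit hq
    rw [closure_union, isClosed_closedBall.closure_eq] at this
    rcases this with h | h
    · exact h
    · rw [mem_closedBall] at h
      linarith [dist_nonneg (x := q) (y := 1), dist_pos.2 hq1]
  -- the near part has compact closure inside the closed half-plane
  have hcl : closure (S ∩ K) ⊆ closure upperHalfPlaneSet :=
    (closure_mono inter_subset_left).trans (closure_mono hS |>.trans (by rw [closure_closure]))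
  have hcpt : IsCompact (closure (S ∩ K)) :=
    hK.of_isClosed_subset isClosed_closure (closure_minimal inter_subset_right hK.isClosed)
  have hcont : ContinuousOn cayleyFun (closure (S ∩ K)) := continuousOn_cayleyFun.mono fun z hz ↦
    add_I_ne_zero (mem_closure_upperHalfPlaneSet_iff.1 (hcl hz))
  have himc : IsClosed (cayleyFun '' closure (S ∩ K)) := (hcpt.image_of_continuousOn hcont).isClosed
  have h1 : closure (cayleyFun '' (S ∩ K)) ⊆ cayleyFun '' closure (S ∩ K) :=
    closure_minimal (image_mono subset_closure) himc
  exact image_mono (closure_mono inter_subset_left) (h1 hq')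

variable {X : Type*} {g : ℝ → X}

/-- A `1`-periodic map is determined by its values on fractional parts. [folklore] -/
theorem _root_.Function.Periodic.map_fract (hp : Periodic g 1) (x : ℝ) : g (Int.fract x) = g x := by
  rw [Int.fract]
  have := hp.sub_int_mul_eq (x := x) ⌊x⌋
  rwa [mul_one] at this

/-- **Shifting a simple periodic loop** keeps it injective on a period. [folklore] -/
theorem _root_.Function.Periodic.injOn_shift (hp : Periodic g 1) (hinj : InjOn g (Ico 0 1)) (c : ℝ) :
    InjOn (fun t ↦ g (t + c)) (Ico 0 1) := by
  intro s hs t ht hst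
  simp only at hst
  rw [← hp.map_fract (s + c), ← hp.map_fract (t + c)] at hst
  have h1 := hinj ⟨Int.fract_nonneg _, Int.fract_lt_one _⟩ ⟨Int.fract_nonneg _, Int.fract_lt_one _⟩ hst
  obtain ⟨z, hz⟩ := Int.fract_eq_fract.1 h1
  have hz' : (s - t : ℝ) = z := by linarith
  have habs : |(z : ℝ)| < 1 := by
    rw [← hz', abs_sub_lt_iff]
    exact ⟨by linarith [hs.1, hs.2, ht.1, ht.2], by linarith [hs.1, hs.2, ht.1, ht.2]⟩
  have hz0 : z = 0 := by
    have : |z| < 1 := by exact_mod_cast habs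
    exact Int.abs_lt_one_iff.1 this
  rw [hz0, Int.cast_zero, sub_eq_zero] at hz'
  exact hz'

/-- Shifting the parameter does not change the range. [folklore] -/
theorem range_comp_add_right (g : ℝ → X) (c : ℝ) : range (fun t ↦ g (t + c)) = range g := by
  ext x
  constructor
  · rintro ⟨t, rfl⟩; exact ⟨t + c, rfl⟩
  · rintro ⟨t, rfl⟩; exact ⟨t - c, by simp⟩

end Tools

/-! ### The hull subdomain of a smooth hull -/

section Main

variable {D : DobrushinDomain} {φ : ConformalEquiv upperHalfPlaneSet D.carrier} {J : Set ℂ}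

/-- **A smooth `*`-hull is the pull-back of a Jordan hull subdomain.** For a chordal
uniformizing map `φ` of `(D; a, b)` and a smooth hull `J ∌ 0`, there is a Dobrushin domain `D'`,
a hull subdomain of `D`, with carrier `φ(ℍ ∖ J)` (module docstring, steps 2–3; from the Jordan
curve theorem `hJCT` and Carathéodory's theorem `hC`). [folklore] -/
theorem exists_isHullSubdomain_of_isArcHull (hJCT : Literature.Topology.PlaneTopology.JordanCurveTheorem)
    (hC : JordanDomain.exists_continuousOn_extension) (hφ : D.IsChordalUniformizing φ)
    (hJ : IsArcHull J) (h0J : (0 : ℂ) ∉ J) :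
    ∃ D' : DobrushinDomain, D.IsHullSubdomain D' ∧ D'.carrier = φ '' (upperHalfPlaneSet \ J) := by
  classical
  obtain ⟨x₀, x₁, P, hlt, hPi, him, hreal, hPJ, hfr, hnotcl, hIccJ⟩ := hJ.sides hJCT
  have hJc : IsClosed J := hJ.1.isClosed
  -- Carathéodory
  obtain ⟨Ψ, hΨc, hΨeq, hbij, -⟩ := hC D.toJordanDomain (cayley.symm.trans φ)
  have hΨinj : InjOn Ψ (closedBall 0 1) := hbij.injOn
  have hφΨ : EqOn φ (Ψ ∘ cayleyFun) upperHalfPlaneSet := JordanDomain.eqOn_comp_cayleyFun φ hΨeq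
  have ha : Ψ (-1) = D.pt 0 := by
    rw [← cayleyFun_zero]
    have h := JordanDomain.extension_cayleyFun_eq φ hΨc hΨeq (x := 0) (p := D.pt 0)
      (by simpa using hφ.1)
    simpa using h
  have hb : Ψ 1 = D.pt 1 := by
    haveI := neBot_cocompact_inf_principal_upperHalfPlaneSet
    exact tendsto_nhds_unique (JordanDomain.tendsto_cocompact_of_extension φ hΨc hΨeq) hφ.2
  have hcmem : ∀ {z : ℂ}, 0 ≤ z.im → cayleyFun z ∈ closedBall (0 : ℂ) 1 := fun hz ↦
    mem_closedBall_zero_iff.2 (norm_cayleyFun_le_one hz)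
  -- the two pieces of the disc loop
  set p₁ : Path (cayleyFun (x₀ : ℂ)) (cayleyFun (x₁ : ℂ)) :=
    { toFun := fun s ↦ cayleyFun (P s)
      continuous_toFun := continuousOn_cayleyFun.comp_continuous P.continuous
        fun s ↦ add_I_ne_zero (him s)
      source' := by simp only [P.source]
      target' := by simp only [P.target] } with hp₁
  have hp₁_apply : ∀ s, p₁ s = cayleyFun (P s) := fun s ↦ rfl
  have hp₁inj : Injective p₁ := fun s t h ↦ hPi (cayleyFun_injOn (him s) (him t) h)
  have hmeet : ∀ w ∈ range p₁ ∩ range (boundaryArc hlt),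
      w = cayleyFun (x₀ : ℂ) ∨ w = cayleyFun (x₁ : ℂ) := by
    rintro w ⟨⟨s, rfl⟩, ⟨s', hs'⟩⟩
    have hn : ‖cayleyFun (P s)‖ = 1 := by
      rw [← hp₁_apply, ← hs']
      exact norm_boundaryArc hlt s'
    have him0 : (P s).im = 0 := by
      by_contra h
      have hpos : 0 < (P s).im := lt_of_le_of_ne (him s) (Ne.symm h)
      have := (norm_cayleyFun_lt_one_iff (add_I_ne_zero (him s))).2 hpos
      linarith
    rcases hreal s him0 with h | h
    · left; rw [hp₁_apply, h]
    · right; rw [hp₁_apply, h]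
  -- the loop `f` in the closed disc
  set L : Path (cayleyFun (x₀ : ℂ)) (cayleyFun (x₀ : ℂ)) := p₁.trans (boundaryArc hlt) with hL
  set f : ℝ → ℂ := fun s ↦ L.extend (Int.fract s) with hf
  have hfc : Continuous f := Literature.Topology.PlaneTopology.path_continuous_extend_fract L
  have hfp : Periodic f 1 := Literature.Topology.PlaneTopology.path_periodic_extend_fract L
  have hfrange : range f = range p₁ ∪ range (boundaryArc hlt) := by
    rw [hf, Literature.Topology.PlaneTopology.path_range_extend_fract, hL, Path.trans_range]
  have hfinj : InjOn f (Ico 0 1) := by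
    intro s hs t ht hst
    simp only [hf, Int.fract_eq_self.2 hs, Int.fract_eq_self.2 ht] at hst
    exact Literature.Topology.PlaneTopology.injOn_path_extend_trans_Ico' hp₁inj (boundaryArc_injective hlt) hmeet hs ht hst
  have hfball : ∀ s, f s ∈ closedBall (0 : ℂ) 1 := by
    intro s
    have : f s ∈ range f := mem_range_self s
    rw [hfrange] at this
    rcases this with ⟨s', hs'⟩ | ⟨s', hs'⟩
    · rw [← hs', hp₁_apply]; exact hcmem (him s')
    · rw [← hs']; exact mem_closedBall_zero_iff.2 (norm_boundaryArc hlt s').le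
  have hrangeball : range f ⊆ closedBall (0 : ℂ) 1 := by
    rintro _ ⟨s, rfl⟩; exact hfball s
  -- parameters of `-1 = C(0)` and `1 = C(∞)`
  have h0x : (0 : ℝ) ≤ x₀ ∨ x₁ ≤ 0 := by
    by_contra h
    push Not at h
    exact h0J (by simpa using hIccJ 0 h.1.le h.2.le)
  have hrange_fract : ∀ w ∈ range f, ∃ t ∈ Ico (0 : ℝ) 1, f t = w := by
    rintro w ⟨s, rfl⟩
    exact ⟨Int.fract s, ⟨Int.fract_nonneg _, Int.fract_lt_one _⟩, hfp.map_fract s⟩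
  obtain ⟨ta, -, hfta⟩ : ∃ t ∈ Ico (0 : ℝ) 1, f t = -1 := by
    apply hrange_fract
    rw [hfrange, ← cayleyFun_zero]
    have := cayleyFun_mem_range_boundaryArc hlt (y := 0) h0x
    rw [ofReal_zero] at this
    exact Or.inr this
  obtain ⟨tb, -, hftb⟩ : ∃ t ∈ Ico (0 : ℝ) 1, f t = 1 := by
    apply hrange_fract
    rw [hfrange]
    exact Or.inr (one_mem_range_boundaryArc hlt)
  have htab : ¬ ∃ z : ℤ, tb - ta = z := by
    rintro ⟨z, hz⟩
    have h1 : f tb = f ta := by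
      rw [show tb = ta + z by linarith]
      have := hfp.int_mul (z) ta
      simpa using this
    rw [hfta, hftb] at h1
    norm_num at h1
  -- the image loop `g = Ψ ∘ f` and the Jordan curve theorem
  set g : ℝ → ℂ := fun s ↦ Ψ (f s) with hg
  have hgc : Continuous g := hΨc.comp_continuous hfc hfball
  have hgp : Periodic g 1 := fun s ↦ by simp only [hg, hfp s]
  have hginj : InjOn g (Ico 0 1) := fun s hs t ht hst ↦
    hfinj hs ht (hΨinj (hfball s) (hfball t) hst)
  have hgrange : range g = Ψ '' range f := by
    rw [hg, ← range_comp]; rfl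
  obtain ⟨U, V, hUo, hVo, hUc, hVc, hUV, hunion, hfU, -, hUb, hVb⟩ := hJCT.of_periodic hgc hgp hginj
  -- the domain `W = φ(ℍ ∖ J)`
  set W : Set ℂ := φ '' (upperHalfPlaneSet \ J) with hW
  have hWD : W ⊆ D.carrier := by
    rintro _ ⟨z, hz, rfl⟩; exact φ.mapsTo hz.1
  have hWo : IsOpen W := φ.isOpen_image D.isOpen (isOpen_upperHalfPlaneSet.sdiff hJc) sdiff_subset
  have hWc : IsConnected W :=
    (hJ.1.2.2.isPathConnected.isConnected).image _ (φ.continuousOn.mono sdiff_subset)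
  have hWb : Bornology.IsBounded W := D.isBounded.subset hWD
  set S : Set ℂ := cayleyFun '' (upperHalfPlaneSet \ J) with hS
  have hSball : S ⊆ closedBall (0 : ℂ) 1 := by
    rintro _ ⟨z, hz, rfl⟩; exact hcmem hz.1.le
  have hWΨ : W = Ψ '' S := by
    rw [hW, hS, image_image]
    exact image_congr fun z hz ↦ hφΨ hz.1
  -- (W1) `W` misses the loop
  have hW1 : Disjoint W (range g) := by
    rw [Set.disjoint_left]
    rintro _ ⟨z, hz, rfl⟩ hw
    rw [hgrange] at hw
    obtain ⟨q, hq, hqw⟩ := hw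
    rw [hφΨ hz.1] at hqw
    have hqeq : q = cayleyFun z := hΨinj (hrangeball hq) (hcmem hz.1.le) hqw
    rw [hfrange] at hq
    rcases hq with ⟨s, hs⟩ | ⟨s, hs⟩
    · rw [hp₁_apply, hqeq] at hs
      exact hz.2 (hPJ ⟨s, cayleyFun_injOn (him s) (show (0 : ℝ) ≤ z.im from hz.1.le) hs⟩)
    · have hn := norm_boundaryArc hlt s
      rw [hs, hqeq] at hn
      have := (norm_cayleyFun_lt_one_iff (add_I_ne_zero hz.1.le)).2 hz.1
      linarith
  -- (W2) the frontier of `W` lies on the loop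
  obtain ⟨Θ, hΘc, -, hΘΨ, hΨΘ⟩ := JordanDomain.exists_inverse_extension hΨc hbij
  have hW2 : frontier W ⊆ range g := by
    intro w hw
    have hwcl : w ∈ closure W := frontier_subset_closure hw
    have hwW : w ∉ W := fun h ↦ by
      have := hw.2
      rw [hWo.interior_eq] at this
      exact this h
    have hclD : closure W ⊆ closure D.carrier := closure_mono hWD
    have hΘW : Θ '' W ⊆ S := by
      rintro _ ⟨w', hw', rfl⟩
      rw [hWΨ] at hw'
      obtain ⟨q, hq, rfl⟩ := hw'
      rw [hΘΨ q (hSball hq)]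
      exact hq
    have hq : Θ w ∈ closure S := by
      have h1 : Θ '' closure W ⊆ closure (Θ '' W) := (hΘc.mono hclD).image_closure
      exact closure_mono hΘW (h1 ⟨w, hwcl, rfl⟩)
    have hwq : w = Ψ (Θ w) := (hΨΘ w (hclD hwcl)).symm
    rcases closure_image_cayleyFun_subset (sdiff_subset.trans subset_closure) hq with
      ⟨z, hz, hzq⟩ | hq1
    · have hzim : 0 ≤ z.im := mem_closure_upperHalfPlaneSet_iff.1 (closure_mono sdiff_subset hz)
      rcases hzim.lt_or_eq with hpos | hzero
      · -- `z ∈ ℍ ∩ ∂J`: on the arc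
        have hzJ : z ∈ J := by
          by_contra h
          refine hwW ?_
          rw [hwq, ← hzq]
          exact ⟨z, ⟨hpos, h⟩, hφΨ hpos⟩
        have hzfr : z ∈ frontier J := by
          rw [frontier_eq_closure_inter_closure, hJc.closure_eq]
          exact ⟨hzJ, closure_mono (fun u hu ↦ hu.2) hz⟩
        have : z ∈ upperHalfPlaneSet ∩ frontier J := ⟨hpos, hzfr⟩
        rw [hfr] at this
        obtain ⟨s, -, rfl⟩ := this
        rw [hwq, ← hzq, hgrange, hfrange]
        exact ⟨_, Or.inl ⟨s, rfl⟩, rfl⟩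
      · -- `z` real, outside `(x₀, x₁)`: on the boundary arc
        have hzre : z = ((z.re : ℝ) : ℂ) := Complex.ext (by simp) (by simp [← hzero])
        have hout : z.re ≤ x₀ ∨ x₁ ≤ z.re := by
          by_contra h
          push Not at h
          exact hnotcl z.re h.1 h.2 (hzre ▸ hz)
        rw [hwq, ← hzq, hgrange, hfrange, hzre]
        exact ⟨_, Or.inr (cayleyFun_mem_range_boundaryArc hlt hout), rfl⟩
    · rw [hwq, hq1, hgrange, hfrange]
      exact ⟨1, Or.inr (one_mem_range_boundaryArc hlt), rfl⟩
  -- hence `W` is the inside of the loop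
  have hclaim : ∀ O : Set ℂ, IsOpen O → IsPreconnected O → O ⊆ (range g)ᶜ → W ⊆ O → O ⊆ W := by
    intro O hOo hOc hOg hWO
    have hOW : IsOpen (O \ W) := by
      rw [isOpen_iff_mem_nhds]
      intro u hu
      have hucl : u ∉ closure W := fun hcl ↦ by
        have hufr : u ∈ frontier W := ⟨hcl, by rw [hWo.interior_eq]; exact hu.2⟩
        exact hOg hu.1 (hW2 hufr)
      filter_upwards [hOo.mem_nhds hu.1, isClosed_closure.isOpen_compl.mem_nhds hucl] with v hv hv'
      exact ⟨hv, fun hvW ↦ hv' (subset_closure hvW)⟩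
    have hsub : O ⊆ W ∪ (O \ W) := fun u hu ↦ by
      by_cases huW : u ∈ W
      · exact Or.inl huW
      · exact Or.inr ⟨hu, huW⟩
    rcases hOc.subset_or_subset hWo hOW disjoint_sdiff_right hsub with h | h
    · exact h
    · exfalso
      obtain ⟨w, hw⟩ := hWc.nonempty
      exact (h (hWO hw)).2 hw
  have hWU : W = U := by
    have hWsub : W ⊆ U ∪ V := by
      rw [hunion]; exact hW1.subset_compl_right
    rcases hWc.isPreconnected.subset_or_subset hUo hVo hUV hWsub with h | h
    · exact Subset.antisymm h (hclaim U hUo hUc.isPreconnected (hunion ▸ subset_union_left) h)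
    · exfalso
      exact hVb (hWb.subset (hclaim V hVo hVc.isPreconnected (hunion ▸ subset_union_right) h))
  have hfrontW : frontier W = range g := by rw [hWU, hfU]
  -- the Dobrushin domain
  have hfract : 0 < Int.fract (tb - ta) := by
    rcases (Int.fract_nonneg (tb - ta)).lt_or_eq with h | h
    · exact h
    · exfalso
      refine htab ⟨⌊tb - ta⌋, ?_⟩
      have := Int.fract_add_floor (tb - ta)
      linarith
  let D' : DobrushinDomain :=
    { carrier := W
      boundary := fun t ↦ g (t + ta)
      isOpen := hWo
      isBounded := hWb
      isConnected := hWc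
      continuous_boundary := hgc.comp (continuous_id.add continuous_const)
      periodic_boundary := fun t ↦ by
        show g (t + 1 + ta) = g (t + ta)
        rw [add_right_comm]
        exact hgp (t + ta)
      injOn_boundary := hgp.injOn_shift hginj ta
      range_boundary := by rw [range_comp_add_right g ta, hfrontW]
      mark := ![0, Int.fract (tb - ta)]
      strictMono_mark := by
        refine Fin.strictMono_iff_lt_succ.2 fun k ↦ ?_
        fin_cases k
        simpa using hfract
      mark_mem := fun k ↦ by
        fin_cases k
        · simp
        · exact ⟨Int.fract_nonneg (tb - ta), Int.fract_lt_one (tb - ta)⟩ }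
  have hpt0 : D'.pt 0 = D.pt 0 := by
    show g (0 + ta) = D.pt 0
    rw [zero_add, hg]
    simp only
    rw [hfta, ha]
  have hpt1 : D'.pt 1 = D.pt 1 := by
    show g (Int.fract (tb - ta) + ta) = D.pt 1
    rw [hg]
    simp only
    have : f (Int.fract (tb - ta) + ta) = f tb := by
      rw [Int.fract, show tb - ta - (⌊tb - ta⌋ : ℝ) + ta = tb - (⌊tb - ta⌋ : ℝ) * 1 by ring]
      exact hfp.sub_int_mul_eq ⌊tb - ta⌋
    rw [this, hftb, hb]
  -- the removed part `D ∖ W = φ(J ∩ ℍ)` stays away from `a` and `b`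
  set T : Set ℂ := Ψ '' (cayleyFun '' J) with hT
  have hTc : IsClosed T := by
    have h1 : IsCompact (cayleyFun '' J) := hJ.1.isCompact.image_of_continuousOn
      (continuousOn_cayleyFun.mono fun z hz ↦ add_I_ne_zero
        (mem_closure_upperHalfPlaneSet_iff.1 (hJ.1.subset_closure hz)))
    have h2 : cayleyFun '' J ⊆ closedBall (0 : ℂ) 1 := by
      rintro _ ⟨z, hz, rfl⟩
      exact hcmem (mem_closure_upperHalfPlaneSet_iff.1 (hJ.1.subset_closure hz))
    exact (h1.image_of_continuousOn (hΨc.mono h2)).isClosed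
  have hDW : D.carrier \ W ⊆ T := by
    rintro w ⟨hwD, hwW⟩
    obtain ⟨z, hz, rfl⟩ := φ.bijOn.surjOn hwD
    have hzJ : z ∈ J := by
      by_contra h
      exact hwW ⟨z, ⟨hz, h⟩, rfl⟩
    rw [hφΨ hz]
    exact ⟨_, ⟨z, hzJ, rfl⟩, rfl⟩
  have hclT : closure (D.carrier \ W) ⊆ T := closure_minimal hDW hTc
  have haT : D.pt 0 ∉ T := by
    rintro ⟨_, ⟨z, hzJ, rfl⟩, hz⟩
    rw [← ha, ← cayleyFun_zero] at hz
    have hzim : 0 ≤ z.im := mem_closure_upperHalfPlaneSet_iff.1 (hJ.1.subset_closure hzJ)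
    have h1 := hΨinj (hcmem hzim) (hcmem (by simp)) hz
    have h2 := cayleyFun_injOn hzim (by simp) h1
    exact h0J (h2 ▸ hzJ)
  have hbT : D.pt 1 ∉ T := by
    rintro ⟨_, ⟨z, hzJ, rfl⟩, hz⟩
    rw [← hb] at hz
    have hzim : 0 ≤ z.im := mem_closure_upperHalfPlaneSet_iff.1 (hJ.1.subset_closure hzJ)
    have h1 := hΨinj (hcmem hzim) (mem_closedBall_zero_iff.2 (by simp)) hz
    exact cayleyFun_ne_one _ h1
  exact ⟨D', ⟨hWD, hpt0, hpt1, fun h ↦ haT (hclT h), fun h ↦ hbT (hclT h)⟩, rfl⟩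

/-- **The pulled-back hull of the hull subdomain of `J` is `J`.** [folklore] -/
theorem pullbackHull_eq_of_carrier_eq {D' : DobrushinDomain} (hJ : IsBoundedHull J)
    (h : D'.carrier = φ '' (upperHalfPlaneSet \ J)) : φ.pullbackHull D' = J := by
  have hdom : φ.pullbackDomain D' = upperHalfPlaneSet \ J := by
    ext z
    constructor
    · rintro ⟨hz, hzD⟩
      rw [h] at hzD
      obtain ⟨z', hz', he⟩ := hzD
      have := φ.injOn hz'.1 hz he
      exact this ▸ hz'
    · intro hz
      exact ⟨hz.1, by rw [h]; exact ⟨z, hz, rfl⟩⟩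
  rw [ConformalEquiv.pullbackHull, hdom, sdiff_sdiff_right_self, inter_comm, hJ.closure_inter_eq]

/-- **Restriction over Jordan hull subdomains gives multiplicativity over smooth hulls**, for the
pull-back law of a chordal, conformally covariant family carried by simple curves
(`ChordalFamily.pullbackLaw`, `RestrictionPullback`) — packaged as: every smooth `*`-hull is
`φ.pullbackHull D'` for a hull subdomain `D'`. [folklore] -/
theorem exists_isHullSubdomain_pullbackHull_eq (hJCT : Literature.Topology.PlaneTopology.JordanCurveTheorem)
    (hC : JordanDomain.exists_continuousOn_extension) (hφ : D.IsChordalUniformizing φ)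
    (hJ : IsArcHull J) (h0J : (0 : ℂ) ∉ J) :
    ∃ D' : DobrushinDomain, D.IsHullSubdomain D' ∧ φ.pullbackHull D' = J := by
  obtain ⟨D', hD', hcar⟩ := exists_isHullSubdomain_of_isArcHull hJCT hC hφ hJ h0J
  exact ⟨D', hD', pullbackHull_eq_of_carrier_eq hJ.1 hcar⟩

end Main

end Literature.Probability.RandomPlanarGeometry

end
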